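import Summits.BirchSwinnertonDyer.Rank1Residual.Additive.RamifiedSevenGenusTwistedUnitShape
import HarnessLib

set_option autoImplicit false

/-!
# `𝒞₇` genus road (crux `EllipticUnitValueSevenOfGZK`, K7r), the (5)-unit programme (SUMMON GENUS-UNIT-A5), File C2b-γ (memo S4/S7,
# D963 (ii)): EVERY character `χ` of `Gal(L/ℚ)`, `L ≤ ℚ(ζ_m)` normal, HAS A DIRICHLET READING `ψ` mod `m` in the D950 shape —
# with `ψ ≠ 1` when `χ ≠ 1` and `ψ(−1) = χ(c|_L)` (so `ψ` is even exactly when `χ` is); THEOREMS ONLY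

Cell bsd-cm, seat bsd-cm-k-ty1 g26 (literature-prover); memo `pub/bsd-cm/bsd-cm-k-ty1/g26/G45-typing-memo.md` S4 (c225f82434dc25c5).
The B-files and ★★★′ take the genus character as a pair `(χ, ψ)` with the READING hypothesis
`hread : ∀ σ g a, (∀ x, (g x : ℚ̄) = σ x) → σ ζ = ζ ^ a → χ g = ψ a`; to apply ★★★′ to an ARBITRARY even character `χ ≠ 1` of
`Gal(F′ₙ/ℚ)` (C2b's case (γ)), the successor needs such a `ψ` to EXIST.  Here it is constructed: `ψ := χ ∘ T ∘ (unit ↦ σ_y|_L)`,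
`T : (ℤ/m)ˣ → Gal(L/ℚ)` the surjective transport of B3a (`σ_y ζ = ζ^y`, `exists_absGal_apply_eq_pow`), packaged by Mathlib's
`MulChar.ofUnitHom`.

* `exists_transport` — the surjective hom `T : (ZMod m)ˣ →* Gal(L/ℚ)` with automorphisms `σ_y` of `ℚ̄`, `σ_y ζ = ζ^{y.val}`, `T y = σ_y|_L`.
* ★ `exists_dirichletReading` — `∃ ψ : DirichletCharacter ℂ m` reading `χ` at `ζ` (D950 shape), with `χ ≠ 1 → ψ ≠ 1` and
  `ψ (-1) = χ g` for every `g = c|_L`, `c ∈ Gal(ℚ̄/ℚ)` with `c ζ = ζ⁻¹` (complex conjugation under any embedding; instance-free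
  phrasing of `c.restrictNormal L`).
* `GenusFrame.exists_dirichletReading_layer` — the pin: every `χ` of `Gal(F′ₙ/ℚ)` is read mod `mₙ = 7^{n+1}|D|` at `ζsys n`.

HONEST LABEL: Galois bookkeeping; no definition, no named fact, no instance; nothing closes; stmt-BirchSwinnertonDyer-19945 OPEN; K1ᵘ NOT
proved; no summit statement is proved by this seat.

## References
* L. C. Washington, *Introduction to Cyclotomic Fields* (1997) Ch. 3 pp. 19–21 (Dirichlet characters as characters of `Gal(ℚ(ζ_m)/ℚ)` and of
  its quotients), Thm. 2.5 [Washington1997]; T. Tsuji, J. Number Theory 78 (1999) §3 (p. 6), §6 [Tsuji1999].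
* Tree: B3a (`exists_absGal_apply_eq_pow`, `apply_eq_of_apply_eq_of_le_adjoin`, `pow_val_mul`), B2b (`coe_restrictNormal_apply`), B1
  (`GenusFrame.isPrimitiveRoot_ζsys`), `RamifiedSevenGenusSinnottNorm.lean` (`layer_le_adjoin_ζsys`).
-/

noncomputable section

open scoped NumberField
open Field

namespace Summit.BirchSwinnertonDyer.Rank1Residual.Additive.GenusSeven

section Reading

variable {m : ℕ} [NeZero m]

/-- **The transport `T : (ℤ/m)ˣ ↠ Gal(L/ℚ)`** for `L ≤ ℚ(ζ)` normal: automorphisms `σ_y` of `ℚ̄` with `σ_y ζ = ζ^{y}` and a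
SURJECTIVE hom `T` with `T y = σ_y|_L` (B3a's in-proof construction, exported). [cite: Washington1997, Thm. 2.5] -/
theorem exists_transport {ζ : AlgebraicClosure ℚ} (hζ : IsPrimitiveRoot ζ m) (L : IntermediateField ℚ (AlgebraicClosure ℚ))
    [Normal ℚ L] (hL : L ≤ IntermediateField.adjoin ℚ {ζ}) :
    ∃ (σ : (ZMod m)ˣ → (AlgebraicClosure ℚ ≃ₐ[ℚ] AlgebraicClosure ℚ)) (T : (ZMod m)ˣ →* (L ≃ₐ[ℚ] L)),
      (∀ y, σ y ζ = ζ ^ ((y : ZMod m)).val) ∧ (∀ y (x : L), ((T y x : L) : AlgebraicClosure ℚ) = σ y x) ∧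
      Function.Surjective T := by
  classical
  haveI : IsAlgClosure ℚ (AlgebraicClosure ℚ) := isAlgClosure_rat_algebraicClosure
  haveI : Normal ℚ (AlgebraicClosure ℚ) := IsAlgClosure.normal ℚ _
  choose σ hσ using fun y : (ZMod m)ˣ => exists_absGal_apply_eq_pow hζ y
  have hTL : ∀ (y : (ZMod m)ˣ) (x : L), (((σ y).restrictNormal L x : L) : AlgebraicClosure ℚ) = σ y x :=
    fun y x => coe_restrictNormal_apply L (σ y) x
  have hσmul : ∀ (y₁ y₂ : (ZMod m)ˣ) {x : AlgebraicClosure ℚ}, x ∈ L → σ (y₁ * y₂) x = σ y₁ (σ y₂ x) := by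
    intro y₁ y₂ x hx
    refine apply_eq_of_apply_eq_of_le_adjoin hL (σ := σ (y₁ * y₂)) (τ := σ y₁ * σ y₂) ?_ hx
    rw [AlgEquiv.mul_apply, hσ, hσ, map_pow, hσ, Units.val_mul, pow_val_mul hζ.pow_eq_one]
  have hTmul : ∀ y₁ y₂ : (ZMod m)ˣ,
      (σ (y₁ * y₂)).restrictNormal L = (σ y₁).restrictNormal L * (σ y₂).restrictNormal L := by
    intro y₁ y₂
    apply AlgEquiv.ext
    intro x
    apply Subtype.ext
    rw [hTL, AlgEquiv.mul_apply, hTL, hTL]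
    exact hσmul y₁ y₂ x.2
  refine ⟨σ, MonoidHom.mk' (fun y => (σ y).restrictNormal L) hTmul, hσ, fun y x => hTL y x, fun g => ?_⟩
  obtain ⟨τ, hτ⟩ := AlgEquiv.restrictNormalHom_surjective (F := ℚ) (E := AlgebraicClosure ℚ) (K₁ := L) g
  have hrN : AlgEquiv.restrictNormalHom L τ = τ.restrictNormal L := rfl
  rw [hrN] at hτ
  have hτζ : IsPrimitiveRoot (τ ζ) m := hζ.map_of_injective τ.injective
  obtain ⟨a, ha, haζ⟩ := hζ.eq_pow_of_pow_eq_one hτζ.pow_eq_one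
  have hcop : a.Coprime m := (hζ.pow_iff_coprime (NeZero.pos m) a).mp (haζ ▸ hτζ)
  refine ⟨ZMod.unitOfCoprime a hcop, ?_⟩
  rw [← hτ, MonoidHom.mk'_apply]
  apply AlgEquiv.ext
  intro x
  apply Subtype.ext
  rw [hTL, coe_restrictNormal_apply]
  refine apply_eq_of_apply_eq_of_le_adjoin hL ?_ x.2
  rw [hσ, ZMod.coe_unitOfCoprime, ZMod.val_natCast, Nat.mod_eq_of_lt ha, haζ]

omit [NeZero m] in
/-- `ζ^{a mod m} = ζ^a` for `ζ^m = 1`. [cite: Washington1997, Thm. 2.5] -/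
theorem pow_val_natCast_eq {R : Type} [Monoid R] {ζ : R} (hζ : ζ ^ m = 1) (a : ℕ) : ζ ^ ((a : ZMod m)).val = ζ ^ a := by
  rw [ZMod.val_natCast]
  conv_rhs => rw [← Nat.mod_add_div a m, pow_add, pow_mul, hζ, one_pow, mul_one]

/-- ★ **Every character of `Gal(L/ℚ)`, `L ≤ ℚ(ζ_m)` normal, has a Dirichlet reading mod `m`** in the D950 shape, non-trivial
when `χ` is, and with `ψ(−1) = χ(c|_L)` for any `c` inverting `ζ` (so `ψ.Even ↔ χ(c|_L) = 1`).
[cite: Washington1997, Ch. 3 (pp. 19–21) and Thm. 2.5] -/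
theorem exists_dirichletReading {ζ : AlgebraicClosure ℚ} (hζ : IsPrimitiveRoot ζ m) (L : IntermediateField ℚ (AlgebraicClosure ℚ))
    [Normal ℚ L] (hL : L ≤ IntermediateField.adjoin ℚ {ζ}) (χ : (L ≃ₐ[ℚ] L) →* ℂˣ) :
    ∃ ψ : DirichletCharacter ℂ m,
      (∀ (σ : AlgebraicClosure ℚ ≃ₐ[ℚ] AlgebraicClosure ℚ) (g : L ≃ₐ[ℚ] L) (a : ℕ),
        (∀ x : L, ((g x : L) : AlgebraicClosure ℚ) = σ x) → σ ζ = ζ ^ a → χ g = ψ a) ∧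
      (χ ≠ 1 → ψ ≠ 1) ∧
      ∀ (c : AlgebraicClosure ℚ ≃ₐ[ℚ] AlgebraicClosure ℚ) (g : L ≃ₐ[ℚ] L),
        (∀ x : L, ((g x : L) : AlgebraicClosure ℚ) = c x) → c ζ = ζ⁻¹ → ψ (-1) = χ g := by
  classical
  obtain ⟨σ, T, hσ, hT, hsurj⟩ := exists_transport hζ L hL
  -- `T y = g` whenever `g = σ'|_L` with `σ' ζ = ζ^{y.val}`
  have hTeq : ∀ (σ' : AlgebraicClosure ℚ ≃ₐ[ℚ] AlgebraicClosure ℚ) (g : L ≃ₐ[ℚ] L) (y : (ZMod m)ˣ),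
      (∀ x : L, ((g x : L) : AlgebraicClosure ℚ) = σ' x) → σ' ζ = ζ ^ ((y : ZMod m)).val → T y = g := by
    intro σ' g y hg hζ'
    apply AlgEquiv.ext
    intro x
    apply Subtype.ext
    rw [hT, hg]
    exact apply_eq_of_apply_eq_of_le_adjoin hL (by rw [hσ, hζ']) x.2
  let ψ : DirichletCharacter ℂ m := MulChar.ofUnitHom (χ.comp T)
  have hψu : ∀ y : (ZMod m)ˣ, ψ (y : ZMod m) = ((χ (T y) : ℂˣ) : ℂ) := fun y => by
    rw [show ψ (y : ZMod m) = ((MulChar.ofUnitHom (χ.comp T) : MulChar (ZMod m) ℂ) (y : ZMod m)) from rfl,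
      MulChar.ofUnitHom_coe, MonoidHom.comp_apply]
  -- the reading
  have hread : ∀ (σ' : AlgebraicClosure ℚ ≃ₐ[ℚ] AlgebraicClosure ℚ) (g : L ≃ₐ[ℚ] L) (a : ℕ),
      (∀ x : L, ((g x : L) : AlgebraicClosure ℚ) = σ' x) → σ' ζ = ζ ^ a → χ g = ψ a := by
    intro σ' g a hg hζ'
    have hprim : IsPrimitiveRoot (ζ ^ a) m := hζ' ▸ hζ.map_of_injective σ'.injective
    have hcop : a.Coprime m := (hζ.pow_iff_coprime (NeZero.pos m) a).mp hprim
    have hy : ((ZMod.unitOfCoprime a hcop : (ZMod m)ˣ) : ZMod m) = (a : ZMod m) := ZMod.coe_unitOfCoprime a hcop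
    have hTy := hTeq σ' g (ZMod.unitOfCoprime a hcop) hg (by rw [hy, pow_val_natCast_eq hζ.pow_eq_one, hζ'])
    rw [← hTy, ← hy, hψu]
  refine ⟨ψ, hread, fun hχ hψ1 => hχ ?_, fun c g hg hc => ?_⟩
  · -- `ψ = 1 ⇒ χ = 1` (T surjective)
    ext g
    obtain ⟨y, rfl⟩ := hsurj g
    have h1 := hψu y
    rw [hψ1, MulChar.one_apply_coe] at h1
    rw [MonoidHom.one_apply, Units.val_eq_one.mp h1.symm]
  · -- `ψ(−1) = χ(g)` for `g = c|_L`: read at `σ' = c`, `a = m − 1`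
    have hζ0 : ζ ≠ 0 := hζ.ne_zero (NeZero.ne m)
    have hm1 : ζ⁻¹ = ζ ^ (m - 1) := by
      rw [eq_comm, ← mul_right_inj' hζ0, ← pow_succ', Nat.sub_add_cancel NeZero.one_le, hζ.pow_eq_one,
        mul_inv_cancel₀ hζ0]
    have h := hread c g (m - 1) hg (by rw [hc, hm1])
    rw [h, Nat.cast_sub NeZero.one_le, Nat.cast_one, ZMod.natCast_self, zero_sub]

end Reading

/-- The pin: **every character of `Gal(F′ₙ/ℚ)` has a Dirichlet reading mod `mₙ = 7^{n+1}|D|` at `ζsys n`**, non-trivial when the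
character is, and even exactly when the character kills complex conjugation. [cite: Tsuji1999, §3 (p. 6) and §6 (p. 20)] -/
theorem GenusFrame.exists_dirichletReading_layer (F : GenusFrame) (n : ℕ) [NeZero (7 ^ (n + 1) * F.d)]
    (χ : (F.layer n ≃ₐ[ℚ] F.layer n) →* ℂˣ) :
    ∃ ψ : DirichletCharacter ℂ (7 ^ (n + 1) * F.d),
      (∀ (σ : AlgebraicClosure ℚ ≃ₐ[ℚ] AlgebraicClosure ℚ) (g : F.layer n ≃ₐ[ℚ] F.layer n) (a : ℕ),
        (∀ x : F.layer n, ((g x : F.layer n) : AlgebraicClosure ℚ) = σ x) → σ (F.ζsys n) = F.ζsys n ^ a → χ g = ψ a) ∧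
      (χ ≠ 1 → ψ ≠ 1) ∧
      ∀ (c : AlgebraicClosure ℚ ≃ₐ[ℚ] AlgebraicClosure ℚ) (g : F.layer n ≃ₐ[ℚ] F.layer n),
        (∀ x : F.layer n, ((g x : F.layer n) : AlgebraicClosure ℚ) = c x) → c (F.ζsys n) = (F.ζsys n)⁻¹ → ψ (-1) = χ g := by
  haveI : Normal ℚ (F.layer n) := F.normal_layer n
  exact exists_dirichletReading (F.isPrimitiveRoot_ζsys n) (F.layer n) (F.layer_le_adjoin_ζsys n) χ

end Summit.BirchSwinnertonDyer.Rank1Residual.Additive.GenusSeven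

end
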